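import Literature.NumberTheory.LFunctions.KowalskiMichelPeterssonJBound
import Literature.NumberTheory.LFunctions.KloostermanWeilPrimeProofs
import HarnessLib

/-!
# Kowalski–Michel (23) with Weil's bound DISCHARGED: the repaired Petersson fact rests on
# Petersson's formula alone; (23) for `J(m, n)` is unconditional

E. Kowalski, P. Michel, *A lower bound for the rank of `J_0(q)`*, Acta Arith. 94 (2000), §2.4.2,
p. 312 [held: paper:doi-10-4064-aa-94-4-303-343, PDF p. 10]:

  "For any `l₁` and `l₂`, Petersson's formula is `∑ʰ_f λ_f(l₁)λ_f(l₂) = δ(l₁,l₂) − J(l₁,l₂)` where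
  `J(l₁, l₂) = (2π/q) ∑_{r ≥ 1} r⁻¹ S(l₁, l₂; qr) J₁(4π √(l₁ l₂)/(qr))`.  The trivial bound for
  this, from Weil's bound for Kloosterman sums and `J₁(x) ≪ x`, is
  (23) `J(l₁, l₂) ≪_ε (l₁ l₂)^{1/2+ε} q^{−3/2}`."

The companion files prove the printed deduction with Weil's bound as a HYPOTHESIS:
`peterssonBound_of_peterssonFormula : kowalskiMichel2000_peterssonFormula → weil_kloosterman_bound →
kowalskiMichel2000_peterssonBound` (`KowalskiMichelPeterssonBoundProof.lean`) and
`norm_petJ_le_of_weil : weil_kloosterman_bound → (23) for J` (`KowalskiMichelPeterssonJBound.lean`).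
But Weil's bound (2.25) of Iwaniec's *Spectral methods*, `|S(m, n; c)| ≤ (m, n, c)^{1/2} c^{1/2} τ(c)`
for every modulus `c`, is a THEOREM of the tree: `weil_kloosterman_bound_holds`
(`KloostermanWeilPrimeProofs.lean`, Stepanov–Schmidt elementary method; prime case
`weil_kloosterman_bound_prime_holds`, reduction `weil_kloosterman_bound_of_prime`).  This file
discharges the hypothesis:

* `peterssonBound_of_peterssonFormula'` — **`kowalskiMichel2000_peterssonFormula →
  kowalskiMichel2000_peterssonBound`**: the repaired harmonic-orthogonality estimate of record
  (p. 310 display with (23) in its range `q ∤ (m, n)`) follows from Petersson's formula AS PRINTED,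
  and from nothing else;
* `norm_petJ_le` — **(23) for `J(m, n)` itself with NO hypothesis**: for every `ε > 0` there is
  `C` with `‖J(m, n)‖ ≤ C (mn)^{1/2+ε} q^{−3/2}` for all primes `q`, all `m, n ≥ 1`, `q ∤ (m, n)`;
* `norm_petKloostermanTerm_le'`, `summable_norm_petKloostermanTerm` — the termwise bound and the
  absolute convergence of the `r`-series on the same range, unconditional;
* `norm_petKloostermanTerm_le_all`, `summable_norm_petKloostermanTerm_all` — absolute convergence
  for ALL `l₁ ≥ 1`, `l₂` (no side condition: with `((l₁,l₂), qr) ≤ (l₁,l₂)` the terms are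
  `≪ √(l₁,l₂) √(l₁l₂) q^{−1/2} r^{−5/4}`), so the convergence clause typed inside
  `kowalskiMichel2000_peterssonFormula` is REDUNDANT:
* `peterssonFormula_iff_identity` — the named fact is EQUIVALENT to the bare printed identity
  `∑ʰ_f λ_f(l₁)λ_f(l₂) = δ(l₁,l₂) − J(l₁,l₂)` (`q` prime, `l₁, l₂ ≥ 1`).

No definition, no named fact.  After this file the only unproved input behind the tree's
Petersson estimate `kowalskiMichel2000_peterssonBound` is Petersson's trace formula at prime level,
weight `2`, as printed.

## References

* E. Kowalski, P. Michel, Acta Arith. 94 (2000), §2.4.2 p. 312, Petersson's formula and (23).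
  [KowalskiMichel2000]
* H. Iwaniec, *Spectral methods of automorphic forms*, 2nd ed. (2002), §2.5 (2.25). [Iwaniec2002]
* W. M. Schmidt, *Equations over Finite Fields*, LNM 536 (1976), Ch. II Thm 2H. [Schmidt1976]
* G. H. Hardy, E. M. Wright, *An Introduction to the Theory of Numbers*, Thm 315. [HardyWright2008]
-/

noncomputable section

open scoped Real
open Literature.Analysis.FunctionSpaces (besselJ abs_besselJ_one_le_half_mul)

namespace Literature.NumberTheory.LFunctions.KowalskiMichel2000

/-! ### Weil's bound discharged in the printed deduction (23) -/

/-- **Kowalski–Michel 2000, (23) ⇒ the repaired Petersson estimate, from Petersson's formula ALONE.**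
`kowalskiMichel2000_peterssonFormula → kowalskiMichel2000_peterssonBound`: for every `ε > 0` there is
`C` with `|∑ʰ_{f ∈ S_2(q)^*} λ_f(m)λ_f(n) − δ(m,n)| ≤ C (mn)^{1/2+ε} q^{−3/2}` for all primes `q` and all
`m, n ≥ 1` with `q ∤ (m, n)`.  This is `peterssonBound_of_peterssonFormula` with its second
hypothesis, Weil's bound (2.25), supplied by the tree's theorem `weil_kloosterman_bound_holds`.
[cite: KowalskiMichel2000, §2.4.2 p. 312 (23)] -/
theorem peterssonBound_of_peterssonFormula' (hF : kowalskiMichel2000_peterssonFormula) :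
    kowalskiMichel2000_peterssonBound :=
  peterssonBound_of_peterssonFormula hF weil_kloosterman_bound_holds

/-- **One term of `J(m, n)`, unconditionally** (Kowalski–Michel p. 312, "from Weil's bound … and
`J₁(x) ≪ x`"): for `q` prime, `q ∤ (m, n)`, `0 < θ ≤ 1` and a divisor-bound constant
`τ(r) ≤ C r^{θ/4}`, `|r⁻¹ S(m,n;qr) J₁(4π√(mn)/(qr))| ≤ 4π C √(mn) q^{−1/2} (m,n)^{θ/2} r^{−1−θ/4}`
(`norm_petKloostermanTerm_le` with Weil's bound supplied by `weil_kloosterman_bound_holds`).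
[cite: KowalskiMichel2000, §2.4.2 p. 312 (23)] -/
theorem norm_petKloostermanTerm_le' {q : ℕ} [NeZero q] (hq : q.Prime) {m n : ℕ} (hm : 1 ≤ m)
    (hmn : ¬ (q ∣ m ∧ q ∣ n)) {θ : ℝ} (hθ0 : 0 < θ) (hθ1 : θ ≤ 1) {C : ℝ}
    (hC : ∀ r : ℕ, ((r.divisors.card : ℕ) : ℝ) ≤ C * (r : ℝ) ^ (θ / 4)) (r : ℕ) :
    ‖petKloostermanTerm q m n r‖ ≤
      4 * π * C * Real.sqrt ((m : ℝ) * n) * (q : ℝ) ^ (-(1 / 2 : ℝ)) *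
        ((m.gcd n : ℕ) : ℝ) ^ (θ / 2) * (r : ℝ) ^ (-(1 + θ / 4)) :=
  norm_petKloostermanTerm_le weil_kloosterman_bound_holds hq hm hmn hθ0 hθ1 hC r

/-- **Absolute convergence of the `r`-series of `J(m, n)`, unconditionally**, on the printed range:
for `q` prime, `m ≥ 1` and `q ∤ (m, n)`, `∑_r ‖r⁻¹ S(m,n;qr) J₁(4π√(mn)/(qr))‖ < ∞`
(`summable_norm_petKloostermanTerm_of_weil` with `weil_kloosterman_bound_holds`).
[cite: KowalskiMichel2000, §2.4.2 p. 312 (23)] -/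
theorem summable_norm_petKloostermanTerm {q : ℕ} [NeZero q] (hq : q.Prime) {m n : ℕ}
    (hm : 1 ≤ m) (hmn : ¬ (q ∣ m ∧ q ∣ n)) :
    Summable (fun r : ℕ ↦ ‖petKloostermanTerm q m n r‖) :=
  summable_norm_petKloostermanTerm_of_weil weil_kloosterman_bound_holds hq hm hmn

/-- **Kowalski–Michel 2000, (23), for `J(m, n)` itself — UNCONDITIONAL:**
"`J(l₁, l₂) ≪_ε (l₁ l₂)^{1/2+ε} q^{−3/2}`": for every `ε > 0` there is `C` such that for all primes
`q` and all `m, n ≥ 1` with `q ∤ (m, n)` (the paper's range "`(m, q) = 1`"),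
`‖J(m, n)‖ ≤ C (mn)^{1/2+ε} q^{−3/2}`; `C = 8π² C_{θ/4} ∑_{r≥1} r^{−1−θ/4}`, `θ = min(ε, 1)`.
No hypothesis: Weil's bound is the tree's `weil_kloosterman_bound_holds`, and Petersson's formula is
not used.  [cite: KowalskiMichel2000, §2.4.2 p. 312 (23)] -/
theorem norm_petJ_le {ε : ℝ} (hε : 0 < ε) :
    ∃ C : ℝ, ∀ (q : ℕ) [NeZero q], q.Prime → ∀ m n : ℕ, 1 ≤ m → 1 ≤ n →
      ¬ (q ∣ m ∧ q ∣ n) →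
        ‖petJ q m n‖ ≤ C * (((m : ℝ) * n) ^ (1 / 2 + ε)) * (q : ℝ) ^ (-(3 / 2 : ℝ)) :=
  norm_petJ_le_of_weil weil_kloosterman_bound_holds hε

/-! ### The `r`-series converges for ALL indices: the convergence clause of the fact is redundant -/

/-- **One term of `J(m, n)` for arbitrary indices** (no side condition): for `q` prime, `m ≥ 1`,
any `n`, and a divisor-bound constant `τ(r) ≤ C r^{1/4}`:
`|r⁻¹ S(m,n;qr) J₁(4π√(mn)/(qr))| ≤ 4π C √(m,n) √(mn) q^{−1/2} r^{−5/4}`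
(Weil (2.25) with the crude gcd bound `((m,n), qr) ≤ (m,n)`, `τ(qr) ≤ 2τ(r)`, `|J₁(x)| ≤ x/2`; the
level saving is worse than in (23) when `q ∣ (m,n)`, but the decay in `r` is the same).
[cite: KowalskiMichel2000, §2.4.2 p. 312 (23) (proof: "from Weil's bound … and J₁(x) ≪ x")] -/
theorem norm_petKloostermanTerm_le_all {q : ℕ} [NeZero q] (hq : q.Prime) {m n : ℕ} (hm : 1 ≤ m)
    {C : ℝ} (hC : ∀ r : ℕ, ((r.divisors.card : ℕ) : ℝ) ≤ C * (r : ℝ) ^ (1 / 4 : ℝ)) (r : ℕ) :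
    ‖petKloostermanTerm q m n r‖ ≤
      4 * π * C * Real.sqrt ((m.gcd n : ℕ) : ℝ) * Real.sqrt ((m : ℝ) * n) *
        (q : ℝ) ^ (-(1 / 2 : ℝ)) * (r : ℝ) ^ (-(5 / 4 : ℝ)) := by
  rcases eq_or_ne r 0 with rfl | hr
  · have h0 : ((0 : ℕ) : ℝ) ^ (-(5 / 4 : ℝ)) = 0 := by
      rw [Nat.cast_zero]
      exact Real.zero_rpow (by norm_num)
    rw [petKloostermanTerm_zero, norm_zero, h0, mul_zero]
  haveI : NeZero (q * r) := ⟨mul_ne_zero hq.ne_zero hr⟩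
  have hq0 : (0 : ℝ) < q := by exact_mod_cast hq.pos
  have hr0 : (0 : ℝ) < r := by exact_mod_cast Nat.pos_of_ne_zero hr
  have hC0 : 0 ≤ C := by
    have h := hC 1
    simp at h
    linarith
  set g : ℕ := m.gcd n with hgdef
  have hgpos : 0 < g := Nat.gcd_pos_of_pos_left n (by omega)
  -- Weil's bound (a theorem of the tree) at modulus `qr`
  have hWeil : ‖kloostermanSum (q * r) (m : ZMod (q * r)) (n : ZMod (q * r))‖ ≤
      Real.sqrt (Nat.gcd g (q * r) : ℕ) * Real.sqrt ((q : ℝ) * r) *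
        (((q * r).divisors.card : ℕ) : ℝ) := by
    have h := weil_kloosterman_bound_holds (q * r) (m : ℤ) (n : ℤ)
    simp only [Int.cast_natCast, Int.natAbs_natCast, Nat.cast_mul] at h
    exact h
  -- the crude gcd bound, the divisor bound and the Bessel bound
  have hgcd : Real.sqrt (Nat.gcd g (q * r) : ℕ) ≤ Real.sqrt (g : ℝ) :=
    Real.sqrt_le_sqrt (by exact_mod_cast Nat.gcd_le_left (q * r) hgpos)
  have hτ : (((q * r).divisors.card : ℕ) : ℝ) ≤ 2 * C * (r : ℝ) ^ (1 / 4 : ℝ) := by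
    calc (((q * r).divisors.card : ℕ) : ℝ) ≤ ((2 * r.divisors.card : ℕ) : ℝ) := by
          exact_mod_cast card_divisors_prime_mul_le hq hr
      _ = 2 * ((r.divisors.card : ℕ) : ℝ) := by push_cast; ring
      _ ≤ 2 * (C * (r : ℝ) ^ (1 / 4 : ℝ)) := by
          gcongr
          exact hC r
      _ = 2 * C * (r : ℝ) ^ (1 / 4 : ℝ) := by ring
  have hx0 : 0 ≤ 4 * π * Real.sqrt ((m : ℝ) * n) / ((q : ℝ) * r) := by positivity
  have hJ : |besselJ 1 (4 * π * Real.sqrt ((m : ℝ) * n) / ((q : ℝ) * r))| ≤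
      (4 * π * Real.sqrt ((m : ℝ) * n) / ((q : ℝ) * r)) / 2 := abs_besselJ_one_le_half_mul hx0
  -- assemble
  rw [petKloostermanTerm_of_ne_zero q m n hr]
  rw [norm_mul, norm_mul, norm_inv, Complex.norm_natCast, Complex.norm_real, Real.norm_eq_abs]
  calc (r : ℝ)⁻¹ * ‖kloostermanSum (q * r) (m : ZMod (q * r)) (n : ZMod (q * r))‖ *
        |besselJ 1 (4 * π * Real.sqrt ((m : ℝ) * n) / ((q : ℝ) * r))|
      ≤ (r : ℝ)⁻¹ * (Real.sqrt (g : ℝ) * Real.sqrt ((q : ℝ) * r) * (2 * C * (r : ℝ) ^ (1 / 4 : ℝ))) *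
          ((4 * π * Real.sqrt ((m : ℝ) * n) / ((q : ℝ) * r)) / 2) := by
        gcongr
        calc ‖kloostermanSum (q * r) (m : ZMod (q * r)) (n : ZMod (q * r))‖
            ≤ Real.sqrt (Nat.gcd g (q * r) : ℕ) * Real.sqrt ((q : ℝ) * r) *
                (((q * r).divisors.card : ℕ) : ℝ) := hWeil
          _ ≤ Real.sqrt (g : ℝ) * Real.sqrt ((q : ℝ) * r) * (2 * C * (r : ℝ) ^ (1 / 4 : ℝ)) := by
              gcongr
    _ = 4 * π * C * Real.sqrt (g : ℝ) * Real.sqrt ((m : ℝ) * n) * (q : ℝ) ^ (-(1 / 2 : ℝ)) *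
          (r : ℝ) ^ (-(5 / 4 : ℝ)) := by
        rw [Real.sqrt_eq_rpow ((q : ℝ) * r), Real.mul_rpow hq0.le hr0.le]
        have er : (r : ℝ)⁻¹ * (r : ℝ) ^ (1 / 2 : ℝ) * (r : ℝ) ^ (1 / 4 : ℝ) / (r : ℝ) =
            (r : ℝ) ^ (-(5 / 4 : ℝ)) := by
          rw [← Real.rpow_neg_one, div_eq_mul_inv, ← Real.rpow_neg_one, ← Real.rpow_add hr0,
            ← Real.rpow_add hr0, ← Real.rpow_add hr0]
          congr 1
          ring
        have eq' : (q : ℝ) ^ (1 / 2 : ℝ) / (q : ℝ) = (q : ℝ) ^ (-(1 / 2 : ℝ)) := by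
          rw [div_eq_mul_inv, ← Real.rpow_neg_one, ← Real.rpow_add hq0]
          congr 1
          ring
        calc (r : ℝ)⁻¹ * (Real.sqrt (g : ℝ) * ((q : ℝ) ^ (1 / 2 : ℝ) * (r : ℝ) ^ (1 / 2 : ℝ)) *
              (2 * C * (r : ℝ) ^ (1 / 4 : ℝ))) *
              ((4 * π * Real.sqrt ((m : ℝ) * n) / ((q : ℝ) * r)) / 2)
            = 4 * π * C * Real.sqrt (g : ℝ) * Real.sqrt ((m : ℝ) * n) *
                ((q : ℝ) ^ (1 / 2 : ℝ) / (q : ℝ)) *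
                ((r : ℝ)⁻¹ * (r : ℝ) ^ (1 / 2 : ℝ) * (r : ℝ) ^ (1 / 4 : ℝ) / (r : ℝ)) := by
              field_simp
          _ = _ := by rw [er, eq']

/-- **The `r`-series of `J(l₁, l₂)` converges absolutely for ALL `l₁ ≥ 1`, `l₂`, `q` prime**
(no side condition; termwise `≪ r^{−5/4}` by `norm_petKloostermanTerm_le_all`).  Hence the clause
`Summable (fun r ↦ ‖petKloostermanTerm q l₁ l₂ r‖)` typed inside `kowalskiMichel2000_peterssonFormula`
is a consequence of Weil's bound, a theorem of the tree.
[cite: KowalskiMichel2000, §2.4.2 p. 312 (23)] -/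
theorem summable_norm_petKloostermanTerm_all {q : ℕ} [NeZero q] (hq : q.Prime) {m n : ℕ}
    (hm : 1 ≤ m) : Summable (fun r : ℕ ↦ ‖petKloostermanTerm q m n r‖) := by
  obtain ⟨C, -, hC⟩ :=
    Literature.NumberTheory.Sieve.exists_card_divisors_le_mul_rpow' (by norm_num : (0 : ℝ) < 1 / 4)
  have hZ : Summable (fun r : ℕ ↦ (r : ℝ) ^ (-(5 / 4 : ℝ))) :=
    Real.summable_nat_rpow.mpr (by norm_num)
  exact Summable.of_nonneg_of_le (fun _ ↦ norm_nonneg _)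
    (fun r ↦ norm_petKloostermanTerm_le_all hq hm (fun r ↦ hC r) r) (hZ.mul_left _)

/-- **The named fact `kowalskiMichel2000_peterssonFormula` is exactly Petersson's identity as
printed** (Kowalski–Michel p. 312: "For any `l₁` and `l₂`, Petersson's formula is
`∑ʰ_f λ_f(l₁)λ_f(l₂) = δ(l₁,l₂) − J(l₁,l₂)`"): the absolute-convergence clause bundled into the typed
statement holds unconditionally (`summable_norm_petKloostermanTerm_all`), so the fact is
equivalent to the bare identity for `q` prime and `l₁, l₂ ≥ 1`.
[cite: KowalskiMichel2000, §2.4.2 p. 312 (Petersson's formula)] -/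
theorem peterssonFormula_iff_identity :
    kowalskiMichel2000_peterssonFormula ↔
      ∀ (q : ℕ) [NeZero q], q.Prime → ∀ l₁ l₂ : ℕ, 1 ≤ l₁ → 1 ≤ l₂ →
        pet q l₁ l₂ = (if l₁ = l₂ then 1 else 0) - petJ q l₁ l₂ := by
  constructor
  · intro h q _ hq l₁ l₂ h₁ h₂
    exact (h q hq l₁ l₂ h₁ h₂).2
  · intro h q _ hq l₁ l₂ h₁ h₂
    exact ⟨summable_norm_petKloostermanTerm_all hq h₁, h q hq l₁ l₂ h₁ h₂⟩

end Literature.NumberTheory.LFunctions.KowalskiMichel2000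

end
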